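import Summits.HodgeConjecture.HodgeConjecture.Theorems.Ring2AbelianAllAndreFibreClassExtremeDegrees
import Summits.HodgeConjecture.HodgeConjecture.Theorems.Ring2AbelianAllAndreFibreClassPointwise
import Summits.HodgeConjecture.HodgeConjecture.Theorems.Ring2AbelianAllAndreWeilPencilsCodim
import Literature.AlgebraicGeometry.HodgeTheory.SmoothFamilyFibreClasses
import HarnessLib

/-!
# Ring 2 · Hypotheses layer (typer2, gen 20, part XXX-B) — the topological supply nodes (κ), (φ) of the André
  axis from the two NAMED PUBLISHED FACTS of `HodgeTheory/SmoothFamilyFibreClasses` (Deligne 1971, Fulton 1998)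

research route conditional on HC_CM; not a corollary; Q11.4-sentence-2 already refuted in dim ≥ 3.

HONEST FRAMING. This file proves NO case of the Hodge conjecture and discharges nothing outright. It is the
typer2 half of LEAD's L16.3 (iii) / §lit L68 (a): the two supply nodes of the André axis of the hypotheses census,
* (κ) `Ring2.AbelianAll.FibreGysinKernelCompactPencils` — `Ker j_{t*} ∩ Im j_t^* = 0` on every compact pencil of
  abelian varieties (Deligne, Hodge II, Thm. 4.1.1 / 4.2.6), and
* (φ) `Ring2.AbelianAll.FibreClassConstantCompactPencils` — the fibre class `j_{t*} 1` does not depend on `t`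
  (Fulton, proof of Prop. 19.1.1),
until now HYPOTHESES displayed wherever used (census columns `K[κ]`, `K[κ, φ]`), follow IN ONE LINE EACH from the
lit seat's named facts (p204378) `HodgeTheory.Deligne1971_fibreGysin_injOn_restricted` (κ̂; print-assembled
corollary of Deligne 4.1.1 + 4.2.6, labelled so in its docstring) and `HodgeTheory.Fulton1998_map_fundamentalClass_fibre_eq`
(φ̂; Fulton Prop. 19.1.1 verbatim in homology), by the Literature transport lemmas
`IsCompactAbelianPencil.restrict_eq_zero_of_fibreGysin_eq_zero` / `IsCompactAbelianPencil.complexGysin_fiberι_one_eq`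
(binder for binder the Summit-side statements). §2 re-exports the census rows that carried `(hκ) (hφ)` over the
two facts: (β∀′) ∈ cl({HC} ∪ {κ̂, φ̂}), the Lefschetz ladder ∈ cl({HC} ∪ {κ̂}), **(β′)₁ ∈ cl{φ̂}** (no Hodge-conjecture
input: ab-andre-2's `fibreClassLefschetzOnAtRelDim_one_of_const`, part XI), and the `HC_CM`-free Weil rows of
`Ring2AbelianAllAndreWeilPencilsCodim` (`WeilSixfolds` / `NonsplitSixfolds` / R∞ from (W_E), κ̂, φ̂ and `HC` of the
squares of the pencils). COUNT ONCE: ab-andre-2's parts XII-a/b give (κ) ∈ cl{h418}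
(`fibreGysinKernelCompactPencils_of_deligne1968`, `h418 = deligne1968_invariantClass_fromTotalSpace`, Voisin II
Thm. 4.18 verbatim) — a citation that DOMINATES κ̂; the rows below are the `K[κ̂]` readings LEAD asked typer2 to land
so that census v9 can flip N56/N57 to cl(FACTS); they add no mathematics.

What is NOT proved here: κ̂, φ̂ themselves (named facts, displayed as binders); any case of the Hodge conjecture.
Net debt: 0 new named facts (both are lit's), 0 `sorry`, standard axioms. Placement: `Summits/` (our obligation
nodes; the published statements are the cited Literature file, used by name).
-/

noncomputable section

set_option linter.dupNamespace false

open CategoryTheory MonoidalCategory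
open Literature.AlgebraicGeometry Literature.AlgebraicGeometry.Motives Literature.AlgebraicGeometry.HodgeTheory
open Summit.HodgeConjecture.HodgeConjecture Summit.HodgeConjecture.HodgeConjecture.Theses
open Summit.HodgeConjecture.HodgeConjecture.Ring2.AbelianAll
open Summit.HodgeConjecture.HodgeConjecture.WeilTypeLadder (WeilClassesImaginaryQuadratic NonsplitSixfolds)
open Summit.HodgeConjecture.HodgeConjecture.Ring2.Deform (CompactAbelianPencilVHC)

namespace Summit.HodgeConjecture.HodgeConjecture.Ring2.Hypotheses

variable {𝒳 S : SchemeOver ℂ}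

/-! ## §1 (κ) and (φ) from the named facts, per pencil and globally -/

/-- **(κ_f) from Deligne's fact**: on a compact pencil of abelian `d`-folds, `j_{t*}(j_t^* W) = 0 ⟹ j_s^* W = 0`
for all `t, s`. One line over lit's `IsCompactAbelianPencil.restrict_eq_zero_of_fibreGysin_eq_zero` (the other
fibres by the tree's PROVED flat-section transport `Andre1996_deformation_hflat`).
[cite: DeligneHodgeII1971, Thm. 4.1.1 and Thm. 4.2.6] [cite: Andre1996Motifs, §6.3 footnote (2) (p. 31)] -/
theorem fibreGysinKernelOn_of_deligne1971 (h : Deligne1971_fibreGysin_injOn_restricted) {d : ℕ} {f : 𝒳 ⟶ S}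
    (hf : IsCompactAbelianPencil f d) : FibreGysinKernelOn hf :=
  fun p t s W hW ↦ hf.restrict_eq_zero_of_fibreGysin_eq_zero h p t s W hW

/-- **(κ) `FibreGysinKernelCompactPencils` from Deligne's fact.** [cite: DeligneHodgeII1971, Thm. 4.1.1 and Thm. 4.2.6] -/
theorem fibreGysinKernelCompactPencils_of_deligne1971 (h : Deligne1971_fibreGysin_injOn_restricted) :
    FibreGysinKernelCompactPencils :=
  fun _ _ _ _ hf ↦ fibreGysinKernelOn_of_deligne1971 h hf

/-- **(φ_f) from Fulton's fact**: the fibre class `j_{t*} 1 ∈ H²(𝒳(ℂ); ℂ)` of a compact pencil does not depend on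
`t`. One line over lit's `IsCompactAbelianPencil.complexGysin_fiberι_one_eq`.
[cite: Fulton1998, §19.1 Prop. 19.1.1 (with proof) and Lemma 19.1.3] -/
theorem fibreClassConstantOn_of_fulton1998 (h : Fulton1998_map_fundamentalClass_fibre_eq) {d : ℕ} {f : 𝒳 ⟶ S}
    (hf : IsCompactAbelianPencil f d) : FibreClassConstantOn hf :=
  fun t t' ↦ hf.complexGysin_fiberι_one_eq h t t'

/-- **(φ) `FibreClassConstantCompactPencils` from Fulton's fact.** [cite: Fulton1998, §19.1 Prop. 19.1.1 (with proof)] -/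
theorem fibreClassConstantCompactPencils_of_fulton1998 (h : Fulton1998_map_fundamentalClass_fibre_eq) :
    FibreClassConstantCompactPencils :=
  fun _ _ _ _ hf ↦ fibreClassConstantOn_of_fulton1998 h hf

/-! ## §2 The census rows that carried `(hκ) (hφ)`, over the two named facts -/

/-- **(β∀′) ∈ cl({HC} ∪ {κ̂, φ̂})**: the repaired fibre-class Lefschetz statement on every compact pencil of abelian
varieties from the Hodge conjecture and the two facts (ab-andre-1's part X-b row, re-based).
[cite: Abdulali1994FamiliesAV, Conjecture 5.3 and Remark 5.4 (p. 1130)] [cite: DeligneHodgeII1971, Thm. 4.1.1 and Thm. 4.2.6]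
[cite: Fulton1998, §19.1 Prop. 19.1.1 (with proof)] -/
theorem fibreClassLefschetzOnCompactPencils_of_hodgeConjecture_of_facts (hκ : Deligne1971_fibreGysin_injOn_restricted)
    (hφ : Fulton1998_map_fundamentalClass_fibre_eq) (h : _root_.HodgeConjecture) : FibreClassLefschetzOnCompactPencils :=
  fibreClassLefschetzOnCompactPencils_of_hodgeConjecture (fibreGysinKernelCompactPencils_of_deligne1971 hκ)
    (fibreClassConstantCompactPencils_of_fulton1998 hφ) h

/-- (β′) on CM-pointed pencils ∈ cl({HC} ∪ {κ̂, φ̂}). [cite: Andre1996Motifs, §6.3 (pp. 31–33)] -/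
theorem fibreClassLefschetzOnCMPointedPencils_of_hodgeConjecture_of_facts (hκ : Deligne1971_fibreGysin_injOn_restricted)
    (hφ : Fulton1998_map_fundamentalClass_fibre_eq) (h : _root_.HodgeConjecture) : FibreClassLefschetzOnCMPointedPencils :=
  fibreClassLefschetzOnCMPointedPencils_of_hodgeConjecture (fibreGysinKernelCompactPencils_of_deligne1971 hκ)
    (fibreClassConstantCompactPencils_of_fulton1998 hφ) h

/-- (β′)_d for every relative dimension `d` ∈ cl({HC} ∪ {κ̂, φ̂}). [cite: Andre1996Motifs, §6.3 (pp. 31–33)] -/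
theorem fibreClassLefschetzOnAtRelDim_of_hodgeConjecture_of_facts (hκ : Deligne1971_fibreGysin_injOn_restricted)
    (hφ : Fulton1998_map_fundamentalClass_fibre_eq) (h : _root_.HodgeConjecture) (d : ℕ) : FibreClassLefschetzOnAtRelDim d :=
  fibreClassLefschetzOnAtRelDim_of_hodgeConjecture (fibreGysinKernelCompactPencils_of_deligne1971 hκ)
    (fibreClassConstantCompactPencils_of_fulton1998 hφ) h d

/-- **(β∀′ᵖᵗ) ∈ cl({HC} ∪ {κ̂})** (the pointwise form needs no (φ)). [cite: DeligneHodgeII1971, Thm. 4.1.1 and Thm. 4.2.6] -/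
theorem fibreClassLefschetzPointwiseCompactPencils_of_hodgeConjecture_of_deligne1971
    (hκ : Deligne1971_fibreGysin_injOn_restricted) (h : _root_.HodgeConjecture) : FibreClassLefschetzPointwiseCompactPencils :=
  fibreClassLefschetzPointwiseCompactPencils_of_hodgeConjecture (fibreGysinKernelCompactPencils_of_deligne1971 hκ) h

/-- **The Lefschetz ladder of the André axis ∈ cl({HC} ∪ {κ̂})**: (β∀′ᵖᵗ), (L∀), (2), (L), (3), (4) (ab-andre-1's
`lefschetzLadder_of_hodgeConjecture_of_kernel`, re-based). [cite: Andre1996Motifs, §6.3 Remarque 2 (p. 33)] -/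
theorem lefschetzLadder_of_hodgeConjecture_of_deligne1971 (hκ : Deligne1971_fibreGysin_injOn_restricted)
    (h : _root_.HodgeConjecture) :
    FibreClassLefschetzPointwiseCompactPencils ∧ AlgebraicFixedPart ∧ CompactAbelianPencilVHC ∧
      CMFibreAlgebraicLift ∧ CMPointedPencilVHC ∧ CMAnchoredTransport :=
  lefschetzLadder_of_hodgeConjecture_of_kernel (fibreGysinKernelCompactPencils_of_deligne1971 hκ) h

/-- **(β′)₁ ∈ cl{φ̂} — NO Hodge-conjecture input, no (κ)**: the fibre-class Lefschetz statement on every compact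
pencil of elliptic curves, from Fulton's fact alone (ab-andre-2's part XI `fibreClassLefschetzOnAtRelDim_one_of_const`:
(κ_f) is PROVED for `d ≤ 1`). [cite: Fulton1998, §19.1 Prop. 19.1.1 (with proof)] -/
theorem fibreClassLefschetzOnAtRelDim_one_of_fulton1998 (hφ : Fulton1998_map_fundamentalClass_fibre_eq) :
    FibreClassLefschetzOnAtRelDim 1 :=
  fibreClassLefschetzOnAtRelDim_one_of_const (fibreClassConstantCompactPencils_of_fulton1998 hφ)

/-- **`WeilSixfolds` from (W_E)₃, κ̂, φ̂ and `HC⁶` of the squares of the rel-dim-6 compact abelian pencils** —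
NO `HC_CM` (ab-andre-2's `weilSixfolds_of_cmPowerWeilPencilsAt_of_kernel_of_codimSix`, re-based).
research route conditional on HC_CM; not a corollary. [cite: Abdulali1994FamiliesAV, Conjecture 5.3 and Remark 5.4 (p. 1130)]
[cite: Andre1996Motifs, §6.3 Remarque 2 (p. 33)] [cite: Weil1977HodgeRing] -/
theorem weilSixfolds_of_cmPowerWeilPencilsAt_of_facts_of_codimSix (hW : CMPowerAnchoredCompactWeilPencilsAt 3)
    (hκ : Deligne1971_fibreGysin_injOn_restricted) (hφ : Fulton1998_map_fundamentalClass_fibre_eq)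
    (halg : ∀ ⦃𝒳 S : SchemeOver ℂ⦄ ⦃f : 𝒳 ⟶ S⦄, IsCompactAbelianPencil f 6 →
      ∀ c : complexBetti (𝒳 ⊗ 𝒳) (2 * 6), IsRationalClass c →
        IsOfHodgeType ((6 + 1) + (6 + 1)) (𝒳 ⊗ 𝒳) (2 * 6) 6 6 c → c ∈ algebraicClasses (𝒳 ⊗ 𝒳) 6) :
    Theses.SevenfoldWeilCensus.WeilSixfolds :=
  weilSixfolds_of_cmPowerWeilPencilsAt_of_kernel_of_codimSix hW (fibreGysinKernelCompactPencils_of_deligne1971 hκ)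
    (fibreClassConstantCompactPencils_of_fulton1998 hφ) halg

/-- The same for `NonsplitSixfolds` (hweil's rung R1′). [cite: Andre1996Motifs, §6.3 Remarque 2 (p. 33)] -/
theorem nonsplitSixfolds_of_cmPowerWeilPencilsAt_of_facts_of_codimSix (hW : CMPowerAnchoredCompactWeilPencilsAt 3)
    (hκ : Deligne1971_fibreGysin_injOn_restricted) (hφ : Fulton1998_map_fundamentalClass_fibre_eq)
    (halg : ∀ ⦃𝒳 S : SchemeOver ℂ⦄ ⦃f : 𝒳 ⟶ S⦄, IsCompactAbelianPencil f 6 →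
      ∀ c : complexBetti (𝒳 ⊗ 𝒳) (2 * 6), IsRationalClass c →
        IsOfHodgeType ((6 + 1) + (6 + 1)) (𝒳 ⊗ 𝒳) (2 * 6) 6 6 c → c ∈ algebraicClasses (𝒳 ⊗ 𝒳) 6) :
    NonsplitSixfolds :=
  nonsplitSixfolds_of_cmPowerWeilPencilsAt_of_kernel_of_codimSix hW (fibreGysinKernelCompactPencils_of_deligne1971 hκ)
    (fibreClassConstantCompactPencils_of_fulton1998 hφ) halg

/-- **Weil's question (R∞) for all `n ≥ 2`** from (W_E)ₙ, κ̂, φ̂ and `HC^{2n}` of the squares of the rel-dim-`2n`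
compact abelian pencils — NO `HC_CM`. [cite: Weil1977HodgeRing] [cite: Abdulali1994FamiliesAV, Conjecture 5.3 (p. 1130)] -/
theorem weilClassesImaginaryQuadratic_of_cmPowerWeilPencils_of_facts_of_codim
    (hW : ∀ n, 2 ≤ n → CMPowerAnchoredCompactWeilPencilsAt n)
    (hκ : Deligne1971_fibreGysin_injOn_restricted) (hφ : Fulton1998_map_fundamentalClass_fibre_eq)
    (halg : ∀ n, 2 ≤ n → ∀ ⦃𝒳 S : SchemeOver ℂ⦄ ⦃f : 𝒳 ⟶ S⦄, IsCompactAbelianPencil f (2 * n) →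
      ∀ c : complexBetti (𝒳 ⊗ 𝒳) (2 * (2 * n)), IsRationalClass c →
        IsOfHodgeType ((2 * n + 1) + (2 * n + 1)) (𝒳 ⊗ 𝒳) (2 * (2 * n)) (2 * n) (2 * n) c →
          c ∈ algebraicClasses (𝒳 ⊗ 𝒳) (2 * n)) :
    WeilClassesImaginaryQuadratic :=
  weilClassesImaginaryQuadratic_of_cmPowerWeilPencils_of_kernel_of_codim hW
    (fibreGysinKernelCompactPencils_of_deligne1971 hκ) (fibreClassConstantCompactPencils_of_fulton1998 hφ) halg

/-! ## §3 Audit -/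

/-- AUDIT: the two supply nodes are one-line consequences of the two named facts. [folklore] -/
theorem fibreClassFacts_audit :
    (Deligne1971_fibreGysin_injOn_restricted → FibreGysinKernelCompactPencils) ∧
      (Fulton1998_map_fundamentalClass_fibre_eq → FibreClassConstantCompactPencils) :=
  ⟨fibreGysinKernelCompactPencils_of_deligne1971, fibreClassConstantCompactPencils_of_fulton1998⟩

end Summit.HodgeConjecture.HodgeConjecture.Ring2.Hypotheses

end
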